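import Mathlib
import Literature.NumberTheory.DiophantineApproximation.SeparatedVariablesAuxiliary
import Literature.RingTheory.MvPowerSeries.LowestOrderIntegrality
import Literature.RingTheory.PowerSeries.DenominatorTypeInversion
import Literature.Analysis.Complex.AuxiliaryCauchyUpperBound
import Literature.Analysis.Complex.PullbackConvergence
import Literature.Analysis.Complex.NevanlinnaMultiplier
import HarnessLib

/-!
# The Calegari–Dimitrov–Tang arithmetic holonomy bound for `p(x) = x^N` (CDT Thm 2.0.1, Lemma 2.0.4)

`Literature/NumberTheory/DiophantineApproximation/ArithmeticHolonomyBound.lean`. Everything here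
is PROVED (no definition, no named fact). We assemble the proof of the dimension bound (2.2) of
F. Calegari, V. Dimitrov, Y. Tang, *The unbounded denominators conjecture* (J. Amer. Math. Soc.
**38** (2025), 627–702; arXiv:2109.09040), Theorem 2.0.1, in the case `p(x) = x^N` of the rational
function `p` — the case used for the unbounded denominators conjecture ("We use Corollary 2.0.2
with `U := ℂ ∖ 16^{-1/N} μ_N`, `p(x) := x^N` …", §3) — and in this file under the additional
hypothesis, established in CDT's proof of Lemma 2.1.1 from `p(x(t)) ∈ ℤ⟦t⟧`, that
`x(t) ∈ t + (t²/M) ℤ⟦t/M⟧`, i.e. `x(t) = M · w(t/M)` with `w ∈ T + T²ℤ⟦T⟧`.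
The denominator type is derived from `x(t)^N ∈ ℤ⟦t⟧` in
`Literature/RingTheory/PowerSeries/NthRootDenominatorType.lean`, which removes this hypothesis.
TODO(general form): `p ∈ ℚ(x)` arbitrary (needs Eisenstein's theorem on the denominators of
algebraic power series) and the algebraicity conclusion of Theorem 2.0.1.

**Theorem 2.0.1 (printed).** "(i) a nonconstant rational function `p(x) ∈ ℚ(x) ∖ ℚ` without pole
at `x = 0`, (ii) a formal power series `x(t) ∈ t + t²ℚ⟦t⟧` pulling back `p` into an integral
coefficients power series `x^* p := p(x(t)) ∈ ℤ⟦t⟧` in the new variable `t`, (iii) and a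
holomorphic mapping `φ : D̄(0,1) → ℂ` taking `φ(0) = 0` with `|φ'(0)| > 1`, and pulling back `p`
into a holomorphic function `φ^* p ∈ 𝒪(D̄(0,1))` on some neighborhood of the closed unit disc.
Suppose the formal power series `f₁, …, f_m ∈ ℚ⟦x⟧` are `ℚ(p(x))`-linearly independent and satisfy
… `x^* f₁, …, x^* f_m ∈ ℤ⟦t⟧`, and `φ^* f₁, …, φ^* f_m ∈ 𝒪(D̄(0,1))`. Then … (2.2)
`m ≤ e · (∫_𝕋 log⁺ |p ∘ φ| μ_Haar) / log |φ'(0)|`."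

**Lemma 2.0.4 (printed).** "In the setting of Theorem 2.0.1, consider furthermore an arbitrary
holomorphic function `h : D̄(0,1) → ℂ` with `h(0) = 1`. Then
`m ≤ e · max{sup_𝕋 log|h|, sup_𝕋 log|h · φ^* p|} / log|φ'(0)|`."

**The formal hypotheses.** `ℚ(p(x))`-linear independence is stated as the absence of a nontrivial
`ℚ[p]`-linear relation (equivalent after clearing denominators); "`φ^* f_i ∈ 𝒪(D̄(0,1))`" is stated
as: the formal composite `f_i(𝓣φ)` (`𝓣φ` the Taylor series of `φ` at `0`) is the Taylor series of a
function holomorphic on a neighbourhood of the closed unit disc.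

**The proof** is CDT's (§§2.1–2.3): the auxiliary construction (Lemma 2.1.1,
`exists_auxiliary_coefficients`, with the coefficient growth of the `f_i` from
`Literature.Analysis.Complex.exists_norm_coeff_le_of_subst_eq` and the denominators from
`Literature.RingTheory.PowerSeries.rescale_mem_range_of_subst_mem_range`), its nonvanishing
(`sum_smul_prod_ne_zero`), the Liouville lower bound (2.6)
(`Literature.RingTheory.MvPowerSeries.one_le_abs_coeff_of_ne_zero`), the Cauchy upper bound (2.7)
with the term estimate (`Literature.Analysis.Complex.norm_deriv_pow_mul_coeff_le`), the limits
`α → ∞`, `d → ∞`, `κ → 0` (`Literature.Analysis.Asymptotics.le_of_forall_linear_bound_nat`,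
`dim_bound_of_linear_bound`, `le_exp_mul_div_of_forall_dim_bound`) — this is Lemma 2.0.4,
`dim_le_of_multiplier_of_denominatorType` — and finally Nevanlinna's multiplier lemma 2.3.1 in the
form `Literature.Analysis.Complex.le_of_forall_multiplier_bound` (§2.3), giving (2.2):
`dim_le_circleAverage_posLog_of_denominatorType`.

## References

* [CalegariDimitrovTang2025] F. Calegari, V. Dimitrov, Y. Tang, The unbounded denominators
  conjecture, J. Amer. Math. Soc. 38 (2025), no. 3, 627–702, Theorem 2.0.1, Lemma 2.0.4,
  §§2.1–2.3; arXiv:2109.09040.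
-/

noncomputable section

namespace Literature.NumberTheory.DiophantineApproximation

open Finset Metric Set Filter Topology
open Literature.RingTheory.MvPowerSeries Literature.RingTheory.PowerSeries
  Literature.Analysis.Complex Literature.Analysis.Asymptotics

/-! ### 1. Bridges between the integer, rational and complex incarnations of `F` -/

/-- **Vanishing of the rational coefficients from the integer equations**: if
`g_{J,s}(Mx) = gz_{J,s}(x)` coefficientwise (`gz ∈ ℤ⟦x⟧`, `map gz = rescale M g`) and the integer
combination `∑_J a_J ∏_s [x^{e_s}] gz_{J,s}` vanishes, then so does the coefficient
`[xᵉ] ∑_J a_J ∏_s g_{J,s}(x_s)`. [folklore] -/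
theorem coeff_sum_smul_prod_eq_zero_of_int {ι : Type*} (Jset : Finset ι) {d : ℕ} {Mden : ℕ}
    (hM : Mden ≠ 0) (g : ι → Fin d → PowerSeries ℚ) (gz : ι → Fin d → PowerSeries ℤ)
    (hg : ∀ j ∈ Jset, ∀ s, (gz j s).map (Int.castRingHom ℚ) = PowerSeries.rescale (Mden : ℚ) (g j s))
    (a : ι → ℤ) (e : Fin d →₀ ℕ)
    (h0 : ∑ j ∈ Jset, a j * ∏ s, PowerSeries.coeff (e s) (gz j s) = 0) :
    MvPowerSeries.coeff e (∑ j ∈ Jset, (a j : ℚ) • ∏ s, ((g j s).toMvPowerSeries s :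
      MvPowerSeries (Fin d) ℚ)) = 0 := by
  rw [coeff_sum_smul_prod_toMvPowerSeries]
  have hMq : (Mden : ℚ) ≠ 0 := by exact_mod_cast hM
  have hcoeff : ∀ j ∈ Jset, ∀ s, ((PowerSeries.coeff (e s) (gz j s) : ℤ) : ℚ) =
      (Mden : ℚ) ^ (e s) * PowerSeries.coeff (e s) (g j s) := by
    intro j hj s
    have h := congrArg (PowerSeries.coeff (e s)) (hg j hj s)
    rw [PowerSeries.coeff_map, eq_intCast, PowerSeries.coeff_rescale] at h
    exact h
  have h1 := congrArg (Int.cast : ℤ → ℚ) h0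
  rw [Int.cast_sum, Int.cast_zero] at h1
  have h2 : ∑ j ∈ Jset, (a j : ℚ) * ∏ s, PowerSeries.coeff (e s) (g j s) =
      ((Mden : ℚ) ^ (∑ s, e s))⁻¹ *
        ∑ j ∈ Jset, ((a j * ∏ s, PowerSeries.coeff (e s) (gz j s) : ℤ) : ℚ) := by
    rw [Finset.mul_sum]
    refine Finset.sum_congr rfl fun j hj ↦ ?_
    rw [Int.cast_mul, Int.cast_prod]
    simp_rw [hcoeff j hj]
    rw [Finset.prod_mul_distrib, Finset.prod_pow_eq_pow_sum]
    field_simp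
  rw [h2, h1, mul_zero]

/-- **Complexification of the coefficients**: the coefficients of
`∑_J c_J ∏_s g_{J,s}(x_s)` computed in `ℂ⟦x⟧` (after `map ℚ → ℂ`) are the images of those computed
in `ℚ⟦x⟧`. [folklore] -/
theorem coeff_sum_smul_prod_map {ι : Type*} (Jset : Finset ι) {d : ℕ} (c : ι → ℚ)
    (g : ι → Fin d → PowerSeries ℚ) (e : Fin d →₀ ℕ) :
    MvPowerSeries.coeff e (∑ j ∈ Jset, (c j : ℂ) • ∏ s,
      (((g j s).map (algebraMap ℚ ℂ)).toMvPowerSeries s : MvPowerSeries (Fin d) ℂ)) =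
      ((MvPowerSeries.coeff e (∑ j ∈ Jset, c j • ∏ s, ((g j s).toMvPowerSeries s :
        MvPowerSeries (Fin d) ℚ)) : ℚ) : ℂ) := by
  rw [coeff_sum_smul_prod_toMvPowerSeries, coeff_sum_smul_prod_toMvPowerSeries, Rat.cast_sum]
  refine Finset.sum_congr rfl fun j _ ↦ ?_
  rw [Rat.cast_mul, Rat.cast_prod]
  refine congrArg ((c j : ℂ) * ·) (Finset.prod_congr rfl fun s _ ↦ ?_)
  rw [PowerSeries.coeff_map, eq_ratCast]

/-- **Integrality after the substitution `x ↦ x(t)`** for the constituents `(x^N)^k f`: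
if `x(t)^N` and `f(x(t))` have integer coefficients, so does `((x^N)^k f)(x(t))`. [folklore] -/
theorem map_pow_mul_eq_subst {x : PowerSeries ℚ} (hx0 : PowerSeries.constantCoeff x = 0) {N k : ℕ}
    {Gx Gf : PowerSeries ℤ} {f : PowerSeries ℚ} (hGx : Gx.map (Int.castRingHom ℚ) = x ^ N)
    (hGf : Gf.map (Int.castRingHom ℚ) = f.subst x) :
    (Gx ^ k * Gf).map (Int.castRingHom ℚ) = ((PowerSeries.X ^ N) ^ k * f).subst x := by
  have hs := PowerSeries.HasSubst.of_constantCoeff_zero' hx0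
  rw [map_mul, map_pow, hGx, hGf, PowerSeries.subst_mul hs, PowerSeries.subst_pow hs,
    PowerSeries.subst_pow hs, PowerSeries.subst_X hs]

/-- The rescaled monomial `P = (Mx)^N ∈ ℤ⟦x⟧` and the size of the coefficients of its powers:
`|[xⁿ] Pᵏ| ≤ Mⁿ`. [folklore] -/
theorem abs_coeff_pow_C_mul_X_pow_le {Mden N : ℕ} (hM : 1 ≤ Mden) {R : ℝ} (hR : (Mden : ℝ) ≤ R)
    (k n : ℕ) :
    |((PowerSeries.coeff n ((PowerSeries.C ((Mden : ℤ) ^ N) * PowerSeries.X ^ N) ^ k) : ℤ) : ℝ)|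
      ≤ R ^ n := by
  have hM0 : (0 : ℝ) ≤ Mden := by positivity
  rw [mul_pow, ← map_pow, ← pow_mul, ← pow_mul, PowerSeries.coeff_C_mul_X_pow]
  split_ifs with h
  · subst h
    push_cast
    rw [abs_pow, abs_of_nonneg hM0]
    exact pow_le_pow_left₀ hM0 hR _
  · simp only [Int.cast_zero, abs_zero]
    exact pow_nonneg (hM0.trans hR) n

/-! ### 2. Lemma 2.0.4 (multiplier form) for `p(x) = x^N` under the denominator hypothesis -/

/-- **CDT Lemma 2.0.4 ("meromorphic form" of the holonomy bound) for `p(x) = x^N`, granted the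
denominator type `x(t) = M w(t/M)`, `w ∈ T + T²ℤ⟦T⟧` of `x(t)`.** With the data and hypotheses of
Theorem 2.0.1 (see the module docstring) and an arbitrary function `h` holomorphic on a
neighbourhood of the closed unit disc with `h(0) = 1`: if `sup_𝕋 log|h| ≤ L` and
`sup_𝕋 log|h φ^N| ≤ L`, then `m ≤ e L / log|φ'(0)|`.
[cite: CalegariDimitrovTang2025, Lemma 2.0.4 and §§2.1–2.2] -/
theorem dim_le_of_multiplier_of_denominatorType {N m Mden : ℕ}
    (hMden : Mden ≠ 0) {w : PowerSeries ℤ} (hw0 : PowerSeries.constantCoeff w = 0)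
    (hw1 : PowerSeries.coeff 1 w = 1) {x : PowerSeries ℚ}
    (hx : x = (Mden : ℚ) • (PowerSeries.subst ((Mden : ℚ)⁻¹ • (PowerSeries.X : PowerSeries ℚ))
      (PowerSeries.map (Int.castRingHom ℚ) w) : PowerSeries ℚ))
    (hxN : ∃ G : PowerSeries ℤ, G.map (Int.castRingHom ℚ) = x ^ N)
    {φ : ℂ → ℂ} (hφ : AnalyticOnNhd ℂ φ (closedBall 0 1)) (hφ0 : φ 0 = 0) (hφ1 : 1 < ‖deriv φ 0‖)
    (f : Fin m → PowerSeries ℚ)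
    (hind : ∀ Q : Fin m → Polynomial ℚ,
      ∑ i, Polynomial.aeval ((PowerSeries.X : PowerSeries ℚ) ^ N) (Q i) * f i = 0 → ∀ i, Q i = 0)
    (hint : ∀ i, ∃ G : PowerSeries ℤ, G.map (Int.castRingHom ℚ) = (f i).subst x)
    (han : ∀ i, ∃ g : ℂ → ℂ, AnalyticOnNhd ℂ g (closedBall 0 1) ∧
      ((f i).map (algebraMap ℚ ℂ)).subst (PowerSeries.mk fun n ↦ iteratedDeriv n φ 0 / n.factorial)
        = PowerSeries.mk fun n ↦ iteratedDeriv n g 0 / n.factorial)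
    {h : ℂ → ℂ} (hh : AnalyticOnNhd ℂ h (closedBall 0 1)) (hh0 : h 0 = 1) {L : ℝ}
    (hL1 : ∀ z ∈ sphere (0 : ℂ) 1, Real.log ‖h z‖ ≤ L)
    (hL2 : ∀ z ∈ sphere (0 : ℂ) 1, Real.log ‖h z * φ z ^ N‖ ≤ L) :
    (m : ℝ) ≤ Real.exp 1 * L / Real.log ‖deriv φ 0‖ := by
  classical
  /- 0. Positivity of `log|φ'(0)|` and `L ≥ 0` (maximum principle), norms from logarithms -/
  set Lφ := Real.log ‖deriv φ 0‖ with hLφ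
  have hLφpos : 0 < Lφ := Real.log_pos hφ1
  have hφ' : deriv φ 0 ≠ 0 := fun h0 ↦ by rw [h0, norm_zero] at hφ1; exact absurd hφ1 (by norm_num)
  have hnorm_of_log : ∀ {v : ℂ}, Real.log ‖v‖ ≤ L → ‖v‖ ≤ Real.exp L := by
    intro v hv
    by_cases hv0 : v = 0
    · rw [hv0, norm_zero]; exact (Real.exp_pos L).le
    · exact (Real.log_le_iff_le_exp (norm_pos_iff.mpr hv0)).mp hv
  have hexp1 : ∀ z ∈ sphere (0 : ℂ) 1, ‖h z‖ ≤ Real.exp L := fun z hz ↦ hnorm_of_log (hL1 z hz)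
  have hexp2 : ∀ z ∈ sphere (0 : ℂ) 1, ‖h z * φ z ^ N‖ ≤ Real.exp L :=
    fun z hz ↦ hnorm_of_log (hL2 z hz)
  have hL0 : 0 ≤ L := by
    have hdc : DiffContOnCl ℂ h (ball 0 1) := DifferentiableOn.diffContOnCl
      (by rw [closure_ball 0 one_ne_zero]; exact hh.differentiableOn)
    have hb := Complex.norm_le_of_forall_mem_frontier_norm_le isBounded_ball hdc
      (fun z hz ↦ hexp1 z (by rwa [frontier_ball (0 : ℂ) one_ne_zero] at hz))
      (subset_closure (mem_ball_self one_pos))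
    rw [hh0, norm_one] at hb
    exact Real.one_le_exp_iff.mp hb
  /- the case `m = 0` -/
  rcases Nat.eq_zero_or_pos m with hm0 | hm
  · subst hm0
    rw [Nat.cast_zero]
    positivity
  /- 1. The data `x`, the integer incarnations, the growth of the coefficients -/
  have hMq : (Mden : ℚ) ≠ 0 := by exact_mod_cast hMden
  have hM1 : 1 ≤ Mden := Nat.one_le_iff_ne_zero.mpr hMden
  have hxresc : x = (Mden : ℚ) • PowerSeries.rescale ((Mden : ℚ)⁻¹)
      (PowerSeries.map (Int.castRingHom ℚ) w) := by
    rw [hx, PowerSeries.rescale_eq_subst]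
  have hcoeffx : ∀ n, PowerSeries.coeff n x =
      (Mden : ℚ) * (((Mden : ℚ)⁻¹) ^ n * ((PowerSeries.coeff n w : ℤ) : ℚ)) := by
    intro n
    rw [hxresc, PowerSeries.coeff_smul, PowerSeries.coeff_rescale, PowerSeries.coeff_map,
      smul_eq_mul, eq_intCast]
  have hx0 : PowerSeries.constantCoeff x = 0 := by
    rw [← PowerSeries.coeff_zero_eq_constantCoeff_apply, hcoeffx,
      PowerSeries.coeff_zero_eq_constantCoeff_apply, hw0, Int.cast_zero, mul_zero, mul_zero]
  have hx1 : PowerSeries.coeff 1 x = 1 := by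
    rw [hcoeffx, hw1, pow_one, Int.cast_one, mul_one, mul_inv_cancel₀ hMq]
  have hw1' : IsUnit (PowerSeries.coeff 1 w) := by rw [hw1]; exact isUnit_one
  -- integer incarnations `fz i` of `f_i(Mx)`
  have hfz : ∀ i, ∃ Fz : PowerSeries ℤ,
      Fz.map (Int.castRingHom ℚ) = PowerSeries.rescale (Mden : ℚ) (f i) := by
    intro i
    obtain ⟨G, hG⟩ := hint i
    exact rescale_mem_range_of_subst_mem_range hMden hw0 hw1' (f := f i) (G := G)
      (by rw [← hx]; exact hG.symm)
  choose fz hfz using hfz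
  -- integrality after `x ↦ x(t)`
  obtain ⟨Gx, hGx⟩ := hxN
  choose Gf hGf using hint
  -- the holomorphic pullbacks `g i = φ^* f_i`
  choose g hg hfg using han
  have hφat : AnalyticAt ℂ φ 0 := hφ 0 (mem_closedBall_self zero_le_one)
  have hgat : ∀ i, AnalyticAt ℂ (g i) 0 := fun i ↦ hg i 0 (mem_closedBall_self zero_le_one)
  -- a common bound `G ≥ 1` for the `g i` on the unit circle
  have hGi : ∀ i, ∃ C, ∀ z ∈ sphere (0 : ℂ) 1, ‖g i z‖ ≤ C := fun i ↦
    (isCompact_sphere (0 : ℂ) 1).exists_bound_of_continuousOn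
      ((hg i).continuousOn.mono sphere_subset_closedBall)
  choose Gi hGi using hGi
  set G : ℝ := 1 + ∑ i, |Gi i| with hGdef
  have hG1 : 1 ≤ G := by
    rw [hGdef]
    have : 0 ≤ ∑ i, |Gi i| := Finset.sum_nonneg fun i _ ↦ abs_nonneg _
    linarith
  have hGbound : ∀ i, ∀ z ∈ sphere (0 : ℂ) 1, ‖g i z‖ ≤ G := by
    intro i z hz
    have h1 : |Gi i| ≤ ∑ j, |Gi j| :=
      Finset.single_le_sum (f := fun j ↦ |Gi j|) (fun j _ ↦ abs_nonneg (Gi j)) (mem_univ i)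
    calc ‖g i z‖ ≤ Gi i := hGi i z hz
      _ ≤ |Gi i| := le_abs_self _
      _ ≤ G := by rw [hGdef]; linarith
  -- complex incarnations and the growth of the coefficients of the `f i` (CDT (2.3))
  set fC : Fin m → PowerSeries ℂ := fun i ↦ (f i).map (algebraMap ℚ ℂ) with hfC
  have hfCg : ∀ i, (fC i).subst (PowerSeries.mk fun n ↦ iteratedDeriv n φ 0 / n.factorial) =
      PowerSeries.mk fun n ↦ iteratedDeriv n (g i) 0 / n.factorial := fun i ↦ hfg i
  obtain ⟨r, hr, Cf, hCf0, hCf⟩ := exists_uniform_norm_coeff_le (F := fC) fun i ↦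
    exists_norm_coeff_le_of_subst_eq hφat hφ0 hφ' (hgat i) (hfCg i)
  -- shrink the radius below `1`
  set r' : ℝ := min r 1 with hr'
  have hr'pos : 0 < r' := lt_min hr one_pos
  have hr'1 : r' ≤ 1 := min_le_right _ _
  have hCf' : ∀ i n, ‖PowerSeries.coeff n (fC i)‖ ≤ Cf / r' ^ n := by
    intro i n
    refine (hCf i n).trans ?_
    exact div_le_div_of_nonneg_left hCf0 (pow_pos hr'pos n)
      (pow_le_pow_left₀ hr'pos.le (min_le_left _ _) n)
  -- the growth parameters `R = M/r' ≥ M ≥ 1`, `B = max 1 Cf`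
  set R : ℝ := Mden / r' with hRdef
  set B : ℝ := max 1 Cf with hBdef
  have hMR : (Mden : ℝ) ≤ R := by
    rw [hRdef, le_div_iff₀ hr'pos]
    exact mul_le_of_le_one_right (by positivity) hr'1
  have hM1' : (1 : ℝ) ≤ Mden := by exact_mod_cast hM1
  have hR1 : 1 ≤ R := hM1'.trans hMR
  have hB1 : 1 ≤ B := le_max_left _ _
  -- the integer data of Lemma 2.1.1: `Pz = (Mx)^N`, `fz i = f_i(Mx)`
  set Pz : PowerSeries ℤ := PowerSeries.C ((Mden : ℤ) ^ N) * PowerSeries.X ^ N with hPz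
  have hPzmap : Pz.map (Int.castRingHom ℚ) = PowerSeries.rescale (Mden : ℚ) (PowerSeries.X ^ N) := by
    rw [hPz, map_mul, PowerSeries.map_C, map_pow (PowerSeries.map (Int.castRingHom ℚ)),
      PowerSeries.map_X, map_pow (PowerSeries.rescale (Mden : ℚ)), PowerSeries.rescale_X, mul_pow,
      ← map_pow PowerSeries.C, eq_intCast, Int.cast_pow, Int.cast_natCast]
  have hPbound : ∀ k n : ℕ, |((PowerSeries.coeff n (Pz ^ k) : ℤ) : ℝ)| ≤ R ^ n :=
    fun k n ↦ abs_coeff_pow_C_mul_X_pow_le hM1 hMR k n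
  have hfbound : ∀ i n, |((PowerSeries.coeff n (fz i) : ℤ) : ℝ)| ≤ B * R ^ n := by
    intro i n
    -- `coeff n (fz i) = M^n coeff n (f i)` and `‖coeff n (f i)‖ ≤ Cf / r'^n`
    have h1 : ((PowerSeries.coeff n (fz i) : ℤ) : ℚ) = (Mden : ℚ) ^ n * PowerSeries.coeff n (f i) := by
      have h := congrArg (PowerSeries.coeff n) (hfz i)
      rw [PowerSeries.coeff_map, eq_intCast, PowerSeries.coeff_rescale] at h
      exact h
    have h2 : ((PowerSeries.coeff n (fz i) : ℤ) : ℝ) =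
        (Mden : ℝ) ^ n * ((PowerSeries.coeff n (f i) : ℚ) : ℝ) := by
      have h := congrArg (Rat.cast : ℚ → ℝ) h1
      rwa [Rat.cast_intCast, Rat.cast_mul, Rat.cast_pow, Rat.cast_natCast] at h
    have h3 : |((PowerSeries.coeff n (f i) : ℚ) : ℝ)| ≤ Cf / r' ^ n := by
      have h := hCf' i n
      rwa [hfC, PowerSeries.coeff_map, eq_ratCast, Complex.norm_ratCast] at h
    rw [h2, abs_mul, abs_pow, abs_of_nonneg (by positivity : (0 : ℝ) ≤ Mden)]
    calc (Mden : ℝ) ^ n * |((PowerSeries.coeff n (f i) : ℚ) : ℝ)| ≤ (Mden : ℝ) ^ n * (Cf / r' ^ n) :=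
          mul_le_mul_of_nonneg_left h3 (by positivity)
      _ = Cf * R ^ n := by rw [hRdef, div_pow]; field_simp
      _ ≤ B * R ^ n := mul_le_mul_of_nonneg_right (le_max_right _ _) (by positivity)
  /- 2. The core inequality for fixed `d ≥ 1`, `κ > 0` and all `α ≥ 1` -/
  have hm0 : (0 : ℝ) < m := by exact_mod_cast hm
  have core : ∀ d : ℕ, 1 ≤ d → ∀ κ : ℝ, 0 < κ → ∀ α : ℕ, 1 ≤ α →
      (α : ℝ) * Lφ ≤
        d * ((1 + κ⁻¹) ^ (d : ℝ)⁻¹ / ((d.factorial : ℝ) ^ (d : ℝ)⁻¹ * m) * (α + d) + 1) * L +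
        κ * Real.log R * α +
        ((1 + κ) * d * Real.log (m * ((1 + κ⁻¹) ^ (d : ℝ)⁻¹ / ((d.factorial : ℝ) ^ (d : ℝ)⁻¹ * m) *
          (α + d) + 1)) + κ * d * Real.log (α * B) + d * Real.log G) := by
    intro d hd κ hκ α hα
    set δ₀ : ℝ := (1 + κ⁻¹) ^ (d : ℝ)⁻¹ / ((d.factorial : ℝ) ^ (d : ℝ)⁻¹ * m) with hδ₀
    -- Lemma 2.1.1
    obtain ⟨D, hD0, hDle, a, ha0, hvan, hheight⟩ :=
      exists_auxiliary_coefficients hm hd Pz fz hR1 hB1 hPbound hfbound hκ hα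
    have hD0' : (0 : ℝ) < D := by exact_mod_cast hD0
    -- the rational auxiliary function `Fℚ` and its constituents
    set gq : (Fin d → Fin m) × (Fin d → Fin D) → Fin d → PowerSeries ℚ :=
      fun J s ↦ (PowerSeries.X ^ N) ^ (J.2 s : ℕ) * f (J.1 s) with hgq
    set Fq : MvPowerSeries (Fin d) ℚ :=
      ∑ J, (a J : ℚ) • ∏ s, ((gq J s).toMvPowerSeries s : MvPowerSeries (Fin d) ℚ) with hFq
    -- (i) vanishing to order `≥ α`
    have hvanq : ∀ e : Fin d →₀ ℕ, e.degree < α → MvPowerSeries.coeff e Fq = 0 := by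
      intro e he
      refine coeff_sum_smul_prod_eq_zero_of_int Finset.univ hMden gq
        (fun J s ↦ Pz ^ (J.2 s : ℕ) * fz (J.1 s)) (fun J _ s ↦ ?_) a e (hvan e he)
      rw [map_mul, map_pow, hPzmap, hfz, ← map_pow, ← map_mul]
    have hordq : (α : ℕ∞) ≤ Fq.order :=
      MvPowerSeries.nat_le_order fun e he ↦ hvanq e (by exact_mod_cast he)
    -- (ii) nonvanishing
    have haq0 : (fun J ↦ (a J : ℚ)) ≠ 0 := by
      intro h0
      apply ha0
      funext J
      have h1 : (a J : ℚ) = 0 := by simpa using congrFun h0 J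
      exact_mod_cast h1
    have hFq0 : Fq ≠ 0 := by
      rw [hFq]
      exact sum_smul_prod_ne_zero f (PowerSeries.X ^ N) hind haq0
    -- (iii) the Liouville lower bound
    obtain ⟨n₀, hn₀ord, hn₀c⟩ := one_le_abs_coeff_of_ne_zero Finset.univ a gq
      (fun J s ↦ Gx ^ (J.2 s : ℕ) * Gf (J.1 s)) hx0 hx1
      (fun J _ s ↦ map_pow_mul_eq_subst hx0 hGx (hGf (J.1 s))) hFq0
    set β : ℕ := n₀.degree with hβ
    have hαβ : α ≤ β := by
      have h1 : ((α : ℕ) : ℕ∞) ≤ (β : ℕ∞) := by rw [hβ, hn₀ord]; exact hordq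
      exact_mod_cast h1
    have hβord : (β : ℕ∞) ≤ Fq.order := le_of_eq hn₀ord
    -- (iv) the complex incarnation and the Cauchy upper bound
    set FC : MvPowerSeries (Fin d) ℂ := ∑ J, ((a J : ℚ) : ℂ) • ∏ s,
      (((PowerSeries.X ^ N) ^ (J.2 s : ℕ) * fC (J.1 s)).toMvPowerSeries s :
        MvPowerSeries (Fin d) ℂ) with hFC
    have hFCmap : FC = ∑ J, ((a J : ℚ) : ℂ) • ∏ s,
        (((gq J s).map (algebraMap ℚ ℂ)).toMvPowerSeries s : MvPowerSeries (Fin d) ℂ) := by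
      rw [hFC]
      refine Finset.sum_congr rfl fun J _ ↦ congrArg _ (Finset.prod_congr rfl fun s _ ↦ ?_)
      rw [hgq, hfC]
      dsimp only
      rw [map_mul (PowerSeries.map (algebraMap ℚ ℂ)), map_pow (PowerSeries.map (algebraMap ℚ ℂ)),
        map_pow (PowerSeries.map (algebraMap ℚ ℂ)), PowerSeries.map_X]
    have hcoeffC : ∀ e, MvPowerSeries.coeff e FC = ((MvPowerSeries.coeff e Fq : ℚ) : ℂ) := by
      intro e
      rw [hFCmap, coeff_sum_smul_prod_map]
    have hβordC : (β : ℕ∞) ≤ FC.order := by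
      refine MvPowerSeries.nat_le_order fun e he ↦ ?_
      rw [hcoeffC, MvPowerSeries.coeff_of_lt_order (lt_of_lt_of_le (by exact_mod_cast he) hβord),
        Rat.cast_zero]
    have hCUP := norm_deriv_pow_mul_coeff_le hh hφ hh0 hφ0 hexp1 hexp2 hg hGbound fC hfCg
      (fun J ↦ ((a J : ℚ) : ℂ)) hβordC rfl
    -- (v) the sum of the `|a_J|`
    set T : ℝ := α * Real.log R + d * Real.log (m * D) + d * Real.log (α * B) with hT
    have hsuma : ∑ J : (Fin d → Fin m) × (Fin d → Fin D), ‖((a J : ℚ) : ℂ)‖ ≤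
        (m : ℝ) ^ d * (D : ℝ) ^ d * Real.exp (κ * T) := by
      have h1 : ∀ J ∈ (Finset.univ : Finset ((Fin d → Fin m) × (Fin d → Fin D))),
          ‖((a J : ℚ) : ℂ)‖ ≤ Real.exp (κ * T) := by
        intro J _
        rw [Complex.norm_ratCast, Rat.cast_intCast, hT]
        exact hheight J
      refine (Finset.sum_le_card_nsmul _ _ _ h1).trans ?_
      rw [Finset.card_univ, Fintype.card_prod, Fintype.card_fun, Fintype.card_fun,
        Fintype.card_fin, Fintype.card_fin, Fintype.card_fin, nsmul_eq_mul]
      push_cast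
      exact le_rfl
    -- (vi) combine (2.6) and (2.7): `|φ'(0)|^β ≤ m^d D^d e^{κT} e^{dDL} G^d`
    have hc1 : 1 ≤ ‖MvPowerSeries.coeff n₀ FC‖ := by
      rw [hcoeffC, Complex.norm_ratCast]
      have hn₀c' : (1 : ℚ) ≤ |MvPowerSeries.coeff n₀ Fq| := hn₀c
      exact_mod_cast hn₀c'
    have hkey : ‖deriv φ 0‖ ^ β ≤
        (m : ℝ) ^ d * (D : ℝ) ^ d * Real.exp (κ * T) * Real.exp (D * L) ^ d * G ^ d := by
      have h1 : ‖deriv φ 0‖ ^ β ≤ ‖deriv φ 0‖ ^ β * ‖MvPowerSeries.coeff n₀ FC‖ :=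
        le_mul_of_one_le_right (by positivity) hc1
      refine h1.trans (hCUP.trans ?_)
      have h2 : 0 ≤ Real.exp (D * L) ^ d * G ^ d := by positivity
      calc (∑ J, ‖((a J : ℚ) : ℂ)‖) * Real.exp (D * L) ^ d * G ^ d
          = (∑ J, ‖((a J : ℚ) : ℂ)‖) * (Real.exp (D * L) ^ d * G ^ d) := by ring
        _ ≤ (m : ℝ) ^ d * (D : ℝ) ^ d * Real.exp (κ * T) * (Real.exp (D * L) ^ d * G ^ d) :=
            mul_le_mul_of_nonneg_right hsuma h2
        _ = _ := by ring
    -- (vii) logarithms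
    set Φ : ℝ := d * Real.log (m * D) + κ * T + d * (D * L) + d * Real.log G with hΦ
    have hG0 : 0 < G := zero_lt_one.trans_le hG1
    have hexpΦ : (m : ℝ) ^ d * (D : ℝ) ^ d * Real.exp (κ * T) * Real.exp (D * L) ^ d * G ^ d =
        Real.exp Φ := by
      rw [hΦ, Real.exp_add, Real.exp_add, Real.exp_add, Real.exp_nat_mul (Real.log (m * D)) d,
        Real.exp_nat_mul ((D : ℝ) * L) d, Real.exp_nat_mul (Real.log G) d,
        Real.exp_log (by positivity), Real.exp_log hG0, mul_pow]
    have hβlog : (β : ℝ) * Lφ ≤ Φ := by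
      have h1 : Real.exp ((β : ℝ) * Lφ) ≤ Real.exp Φ := by
        rw [Real.exp_nat_mul, hLφ, Real.exp_log (norm_pos_iff.mpr hφ'), ← hexpΦ]
        exact hkey
      exact Real.exp_le_exp.mp h1
    have hαlog : (α : ℝ) * Lφ ≤ Φ :=
      (mul_le_mul_of_nonneg_right (by exact_mod_cast hαβ) hLφpos.le).trans hβlog
    -- (viii) replace `D` by its majorant `D̄ = δ₀ (α + d) + 1`
    have hDle' : (D : ℝ) ≤ δ₀ * (α + d) + 1 := by rw [hδ₀]; exact hDle
    have hmD : (0 : ℝ) < m * D := by positivity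
    have hlogD : Real.log (m * D) ≤ Real.log (m * (δ₀ * (α + d) + 1)) :=
      Real.log_le_log hmD (mul_le_mul_of_nonneg_left hDle' hm0.le)
    have hDL : (D : ℝ) * L ≤ (δ₀ * (α + d) + 1) * L := mul_le_mul_of_nonneg_right hDle' hL0
    have hd0 : (0 : ℝ) ≤ d := by positivity
    have h1 := mul_le_mul_of_nonneg_left hlogD (by positivity : (0 : ℝ) ≤ (1 + κ) * d)
    have h2 := mul_le_mul_of_nonneg_left hDL hd0
    have hΦle : Φ ≤ d * (δ₀ * (α + d) + 1) * L + κ * Real.log R * α +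
        ((1 + κ) * d * Real.log (m * (δ₀ * (α + d) + 1)) + κ * d * Real.log (α * B) +
          d * Real.log G) := by
      rw [hΦ, hT]
      linarith [h1, h2]
    rw [hδ₀] at hΦle
    exact hαlog.trans hΦle
  /- 3. The limits `α → ∞`, `d → ∞`, `κ → 0` -/
  have hdim : ∀ d : ℕ, 1 ≤ d → ∀ κ : ℝ, 0 < κ → κ * Real.log R < Lφ →
      (m : ℝ) ≤ (d : ℝ) / (d.factorial : ℝ) ^ ((d : ℝ)⁻¹) * (1 + κ⁻¹) ^ ((d : ℝ)⁻¹) * L /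
        (Lφ - κ * Real.log R) := by
    intro d hd κ hκ hκC
    set δ₀ : ℝ := (1 + κ⁻¹) ^ (d : ℝ)⁻¹ / ((d.factorial : ℝ) ^ (d : ℝ)⁻¹ * m) with hδ₀
    have hδ₀pos : 0 < δ₀ := by
      rw [hδ₀]
      exact div_pos (Real.rpow_pos_of_pos (by positivity) _)
        (mul_pos (Real.rpow_pos_of_pos (by exact_mod_cast Nat.factorial_pos d) _) hm0)
    have hmδ₀ : 0 ≤ (m : ℝ) * δ₀ := mul_nonneg hm0.le hδ₀pos.le
    refine dim_bound_of_linear_bound hm hκC ?_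
    -- `le_of_forall_linear_bound_nat` with `D(α) = d D̄(α)`, `E(α)` the `o(α)` terms
    have hB0 : 0 ≤ B := zero_le_one.trans hB1
    refine le_of_forall_linear_bound_nat (D := fun α : ℕ ↦ (d : ℝ) * (δ₀ * (α + d) + 1))
      (E := fun α : ℕ ↦ (1 + κ) * d * Real.log (m * (δ₀ * (α + d) + 1)) +
        κ * d * Real.log (α * B) + d * Real.log G) ?_ ?_ ?_
    · have heq : (fun α : ℕ ↦ (d : ℝ) * (δ₀ * (α + d) + 1) / α) =
          fun α : ℕ ↦ ((d : ℝ) * δ₀ * α + d * (δ₀ * d + 1)) / α := by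
        funext α; ring
      rw [heq, show (d : ℝ) * ((1 + κ⁻¹) ^ (d : ℝ)⁻¹ / ((d.factorial : ℝ) ^ (d : ℝ)⁻¹ * m)) = d * δ₀ by
        rw [hδ₀]]
      exact tendsto_linear_div_natCast _ _
    · have h1 := (tendsto_log_linear_div_natCast (a := m * δ₀) hmδ₀
        (m * (δ₀ * d + 1))).const_mul ((1 + κ) * d)
      have h2 := (tendsto_log_linear_div_natCast (a := B) hB0 0).const_mul (κ * d)
      have h3 := tendsto_const_div_atTop_nhds_zero_nat ((d : ℝ) * Real.log G)
      have hsum := (h1.add h2).add h3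
      simp only [mul_zero, add_zero] at hsum
      refine hsum.congr fun α ↦ ?_
      have e1 : (m : ℝ) * δ₀ * α + m * (δ₀ * d + 1) = m * (δ₀ * (α + d) + 1) := by ring
      have e2 : B * (α : ℝ) = α * B := by ring
      rw [e1, e2]
      ring
    · refine Filter.eventually_atTop.mpr ⟨1, fun α hα ↦ ?_⟩
      have h := core d hd κ hκ α hα
      rw [← hδ₀] at h
      linarith [h]
  exact le_exp_mul_div_of_forall_dim_bound hLφpos hdim

/-! ### 3. Theorem 2.0.1 (2.2) for `p(x) = x^N` under the denominator hypothesis -/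

/-- **CDT Theorem 2.0.1, bound (2.2), for `p(x) = x^N`, granted the denominator type
`x(t) = M w(t/M)`, `w ∈ T + T²ℤ⟦T⟧` of `x(t)`.** With `x ∈ t + t²ℚ⟦t⟧` of this shape (so that
`x(t)^N ∈ ℤ⟦t⟧` is CDT's hypothesis (ii) for `p = x^N`), `φ` holomorphic about the closed unit
disc with `φ(0) = 0`, `|φ'(0)| > 1`, and `f₁, …, f_m ∈ ℚ⟦x⟧` admitting no nontrivial
`ℚ[x^N]`-linear relation, with `f_i(x(t)) ∈ ℤ⟦t⟧` and `f_i(𝓣φ)` the Taylor series of a function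
holomorphic about the closed unit disc, one has
`m ≤ e · (∫_𝕋 log⁺ |φ^N| μ_Haar) / log |φ'(0)|`.
[cite: CalegariDimitrovTang2025, Theorem 2.0.1 (2.2), via Lemma 2.0.4 and Lemma 2.3.1] -/
theorem dim_le_circleAverage_posLog_of_denominatorType {N m Mden : ℕ}
    (hMden : Mden ≠ 0) {w : PowerSeries ℤ} (hw0 : PowerSeries.constantCoeff w = 0)
    (hw1 : PowerSeries.coeff 1 w = 1) {x : PowerSeries ℚ}
    (hx : x = (Mden : ℚ) • (PowerSeries.subst ((Mden : ℚ)⁻¹ • (PowerSeries.X : PowerSeries ℚ))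
      (PowerSeries.map (Int.castRingHom ℚ) w) : PowerSeries ℚ))
    (hxN : ∃ G : PowerSeries ℤ, G.map (Int.castRingHom ℚ) = x ^ N)
    {φ : ℂ → ℂ} (hφ : AnalyticOnNhd ℂ φ (closedBall 0 1)) (hφ0 : φ 0 = 0) (hφ1 : 1 < ‖deriv φ 0‖)
    (f : Fin m → PowerSeries ℚ)
    (hind : ∀ Q : Fin m → Polynomial ℚ,
      ∑ i, Polynomial.aeval ((PowerSeries.X : PowerSeries ℚ) ^ N) (Q i) * f i = 0 → ∀ i, Q i = 0)
    (hint : ∀ i, ∃ G : PowerSeries ℤ, G.map (Int.castRingHom ℚ) = (f i).subst x)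
    (han : ∀ i, ∃ g : ℂ → ℂ, AnalyticOnNhd ℂ g (closedBall 0 1) ∧
      ((f i).map (algebraMap ℚ ℂ)).subst (PowerSeries.mk fun n ↦ iteratedDeriv n φ 0 / n.factorial)
        = PowerSeries.mk fun n ↦ iteratedDeriv n g 0 / n.factorial) :
    (m : ℝ) ≤ Real.exp 1 * Real.circleAverage (fun w ↦ Real.posLog ‖φ w ^ N‖) 0 1 /
      Real.log ‖deriv φ 0‖ :=
  le_of_forall_multiplier_bound (g := fun z ↦ φ z ^ N) (hφ.pow N) (Real.log_pos hφ1)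
    fun _ hh hh0 _ hL1 hL2 ↦ dim_le_of_multiplier_of_denominatorType hMden hw0 hw1 hx hxN hφ
      hφ0 hφ1 f hind hint han hh hh0 hL1 hL2

end Literature.NumberTheory.DiophantineApproximation
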